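import Summits.HodgeConjecture.HodgeConjecture.Theorems.HodgeLocusCensusLinearCycleRank
import Literature.AlgebraicGeometry.Movasati2017.PeriodMatrixRankLowerBound
import HarnessLib

/-!
# HodgeLocusCensusSecondGap — equality in Movasati's bound and the second gap, for census matrices
# (cell pub-hlocus, lit-g17 second bridge; needs the v3 append of
# `Literature/AlgebraicGeometry/Movasati2017/PeriodMatrixRankLowerBound.lean`)
HONEST FRAMING: certified instances and evidence bearing on the general Hodge conjecture; no claim.

For `n` even and `d ≥ 2 + 6/n` (`(n/2)(d−2) ≥ 3`), every monomial order `mo` on the exponents, every rational combination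
`δ` of linear cycles and every `(K, ζ)`: let `κ` be the `mo`-largest box exponent at which the census period vector
`periodComb n d ζ δ` is non-zero. Then
* if `rank (ivhsMatrix n d ζ δ) = C(n/2+d, d) − (n/2+1)²` (the row ATTAINS Movasati's bound), `κ` is concentrated:
  every exponent of `κ` is `0` or `d − 2` (Villaflor CCM 2022 Prop. 4.1 (igualdad1), Literature
  `leadingExponent_mem_of_rank_eq_movasatiBound`);
* if `κ` is NOT concentrated (`n ≥ 2`), `rank (ivhsMatrix n d ζ δ) ≥ ciLocusCodim (1^{n/2}, 2) d` — the tangent codimension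
  of the complete intersections of type `(1,…,1,2)`, Villaflor's second value (`(4,4) ↦ 8`, `(4,6) ↦ 32`; Literature
  `ciLocusCodim_le_rank_periodMatrix_of_not_concentrated`, Villaflor Thm. 1.3 / Prop. 3.3).
-/

namespace Summit.HodgeConjecture.HodgeConjecture.HodgeLocus.Census

open Literature.AlgebraicGeometry

/-- A census row attaining Movasati's bound has a concentrated leading box exponent (any monomial order, any
admissible `(K, ζ)`), `d ≥ 2 + 6/n`. -/
theorem leadingExponent_mem_of_rank_ivhsMatrix_eq {K : Type*} [Field K] {n d : ℕ} (mo : MonomialOrder (Fin (n + 2)))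
    (hn : Even n) (h6 : 3 ≤ n / 2 * (d - 2)) (ζ : K) (δ : List (ℚ × LinearCycle n))
    {κ : Fin (n + 2) → ℕ} (hκ : κ ∈ Movasati2016.indexSet (n + 2) d ((n / 2 + 1) * (d - 2)))
    (hpκ : periodComb n d ζ δ κ ≠ 0)
    (hmax : ∀ i ∈ Movasati2016.indexSet (n + 2) d ((n / 2 + 1) * (d - 2)),
      Movasati2017.okey mo κ < Movasati2017.okey mo i → periodComb n d ζ δ i = 0)
    (hrank : (ivhsMatrix n d ζ δ).rank = (n / 2 + d).choose d - (n / 2 + 1) ^ 2) :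
    ∀ e, κ e = 0 ∨ κ e = d - 2 := by
  have hd : 2 ≤ d := by
    by_contra h
    have : n / 2 * (d - 2) = 0 := by rw [show d - 2 = 0 by omega, Nat.mul_zero]
    omega
  rw [ivhsMatrix_eq_periodMatrix] at hrank
  have hbox : ∀ i : Fin (n + 2) → ℕ, (∃ e, d - 1 ≤ i e) → periodComb n d ζ δ i = 0 := by
    intro i hi
    have h := MovasatiVillaflor2018.combPeriod_eq_zero_of_le ζ hn hd (δ.map fun x => ((x.1 : K), x.2.a, x.2.b)) hi
    simpa only [periodComb, MovasatiVillaflor2018.combPeriod, List.map_map, period_eq_linearCyclePeriod,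
      Function.comp_def] using h
  have hp : periodComb n d ζ δ = MovasatiVillaflor2018.combPeriod n d ζ (δ.map fun x => ((x.1 : K), x.2.a, x.2.b)) := by
    funext i
    simp only [periodComb, MovasatiVillaflor2018.combPeriod, List.map_map, period_eq_linearCyclePeriod,
      Function.comp_def]
  rw [← hp] at hrank
  exact Movasati2017.leadingExponent_mem_of_rank_eq_movasatiBound mo hn h6 _ hbox hκ hpκ hmax hrank

/-- A census matrix whose leading box exponent is NOT concentrated has rank at least the `(1,…,1,2)` complete-intersection
codimension `ciLocusCodim (1^{n/2}, 2) d` (Villaflor's second gap), `n ≥ 2`, `n + 2 ≤ (n/2)·d`. -/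
theorem ciLocusCodim_le_rank_ivhsMatrix_of_not_concentrated {K : Type*} [Field K] {n d : ℕ}
    (mo : MonomialOrder (Fin (n + 2))) (hn : Even n) (hn2 : 2 ≤ n) (hN : n + 2 ≤ n / 2 * d) (ζ : K)
    (δ : List (ℚ × LinearCycle n))
    {κ : Fin (n + 2) → ℕ} (hκ : κ ∈ Movasati2016.indexSet (n + 2) d ((n / 2 + 1) * (d - 2)))
    (hpκ : periodComb n d ζ δ κ ≠ 0)
    (hmax : ∀ i ∈ Movasati2016.indexSet (n + 2) d ((n / 2 + 1) * (d - 2)),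
      Movasati2017.okey mo κ < Movasati2017.okey mo i → periodComb n d ζ δ i = 0)
    (hmid : ∃ e, 0 < κ e ∧ κ e < d - 2) :
    Kloosterman2023.ciLocusCodim (List.replicate (n / 2) 1 ++ [2]) d ≤ (ivhsMatrix n d ζ δ).rank := by
  have hd : 2 ≤ d := by
    by_contra h
    have : n / 2 * d ≤ n / 2 * 1 := Nat.mul_le_mul_left _ (by omega)
    omega
  rw [ivhsMatrix_eq_periodMatrix]
  have hbox : ∀ i : Fin (n + 2) → ℕ, (∃ e, d - 1 ≤ i e) → periodComb n d ζ δ i = 0 := by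
    intro i hi
    have h := MovasatiVillaflor2018.combPeriod_eq_zero_of_le ζ hn hd (δ.map fun x => ((x.1 : K), x.2.a, x.2.b)) hi
    simpa only [periodComb, MovasatiVillaflor2018.combPeriod, List.map_map, period_eq_linearCyclePeriod,
      Function.comp_def] using h
  have hp : periodComb n d ζ δ = MovasatiVillaflor2018.combPeriod n d ζ (δ.map fun x => ((x.1 : K), x.2.a, x.2.b)) := by
    funext i
    simp only [periodComb, MovasatiVillaflor2018.combPeriod, List.map_map, period_eq_linearCyclePeriod,
      Function.comp_def]
  rw [← hp]
  exact Movasati2017.ciLocusCodim_le_rank_periodMatrix_of_not_concentrated mo hn hn2 hN _ hbox hκ hpκ hmax hmid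

end Summit.HodgeConjecture.HodgeConjecture.HodgeLocus.Census
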